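import Mathlib
import Summits.Ventures.PercRepro2.SwOutFrozenBaseGHinge
import Summits.Ventures.PercRepro2.SwOutWeakCubeRow

/-!
# THE ROW FROM FROZEN BLOCKS AND FROM WEAK-CUBE BLOCKS: the mark step with any set of junctions
on every graph whose fibres are partitioned into frozen / weak-cube blocks (blind cell PercRepro2,
night-4 g38, 2026-08-29; proofs/NIGHT4-G38.md §4)

Frozen blocks are weak-cube blocks (`FrozenBlocks.toWeakCubeBlocks`: the realisation
`decoRealRR`, injective, with the lower set of SwOutFrozenBaseGHinge and the monotone red edge set
and the antipode containment of SwOutFrozenBaseGAntipode), so the weak-cube row of SwOutWeakCubeRow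
applies; directly from the frozen part and class theorems: the graph-level
`gTypedSwAll_of_junctions_frozen` and THE ROW **`swAll_markStep_of_junctions_frozen`**,
`sw_markStep_of_junctions_frozen` — row 2′SW-ALL with the mark `x` on every graph under the frozen
block structure on every fibre of every pattern of the mark's edges.  The census
(mining/night-4/g38/frozencheck.py) certifies the `FrozenDecoG` fields block by block and design
19's c2 / c5 certify the partition: at `n = 7` every block of the 3,562 pairs of design 14 and
45,809 of the 47,866 blocks of the 1,306 open pairs are frozen blocks (675 pairs entirely, 586 of
design 19's 850); at `n = 8` 2,945,017 of 3,023,303 blocks (21,124 of design 19's 24,281 pairs).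
-/

namespace Summit.Ventures.PercRepro2

namespace LocRows

open Hull

universe u v

variable {V : Type u} {E : Type v}

open scoped Classical

variable {ends : E → Sym2 V}

section Blocks

variable [Fintype E] [DecidableEq E] {U : Set V} {ξ : Config E} {l h : V}
  {𝓤 𝓓 𝓓'' : Set (Set V)} {X : Set V} {𝓤' : Set (Set V)}

/-- Frozen blocks are weak-cube blocks: the realisation `decoRealRR` of the frozen base, injective,
with the lower set of SwOutFrozenBaseGHinge and the monotone red edge set and the antipode
containment of SwOutFrozenBaseGMono. -/
theorem FrozenBlocks.toWeakCubeBlocks (h𝓤 : IsUpperSet 𝓤) (h𝓓 : IsLowerSet 𝓓)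
    (h𝓓'' : IsLowerSet 𝓓'') (h𝓤' : IsUpperSet 𝓤') {P : Config E → Prop}
    (hfb : FrozenBlocks ends l h 𝓤 𝓓 𝓓'' X 𝓤' U ξ P) :
    WeakCubeBlocks ends l h 𝓤 𝓓 𝓓'' X 𝓤' U ξ P := by
  obtain ⟨K, key, block, hmem, hblock, hcube⟩ := hfb
  refine ⟨K, key, block, hmem, hblock, fun ζ hζ hP => ?_⟩
  obtain ⟨ι, _, A, Z, RR, ζ₀, R, H, Fz, hd, hh, hX, hblk⟩ := hcube ζ hζ hP
  refine ⟨ι ⊕ ↥RR, inferInstance, inferInstance, decoRealRR ends A Z RR ζ₀,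
    hd.base.decoRealRR_injective, fun ζ' => by rw [hblk]; exact mem_decoCubeRR,
    fun ω' ω hω hQ => hd.decoRealRR_mem_gTypedQ_of_le hh h𝓤 h𝓓 h𝓓'' h𝓤' hX hω hQ,
    fun _ h𝓔' _ _ hω hω𝓔 => h𝓔' (hd.base.redEdges_decoRealRR_mono hh hω) hω𝓔,
    fun ω _ => hd.base.redEdges_flipAll_subset_blueEdges hh ω⟩


section Graph

/-- **THE MULTI-JUNCTION CLASS FROM FROZEN BLOCKS ON THE GRAPH**: the general doubly typed row on
every graph with the junctions `J` in `{l}ᶜ`, under the frozen block structure on every fibre of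
every class. -/
theorem gTypedSwAll_of_junctions_frozen {J : Finset V} (hlh : l ≠ h)
    (h𝓤 : IsUpperSet 𝓤) (h𝓓 : IsLowerSet 𝓓) (h𝓓'' : IsLowerSet 𝓓'') (h𝓤' : IsUpperSet 𝓤')
    (hfb : ∀ ξ, ∀ T ⊆ J, FrozenBlocks ends l h 𝓤 𝓓 𝓓'' X 𝓤' ({l}ᶜ) ξ fun ζ =>
      (∀ r ∈ insert h (↑(J \ T) : Set V), hull ends ζ r ⊆ ({l}ᶜ : Set V)) ∧
        (∀ u ∈ (↑T : Set V), ¬ hull ends ζ u ⊆ ({l}ᶜ : Set V))) :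
    GTypedSwAll ends l h 𝓤 𝓓 𝓓'' X 𝓤' :=
  exists_swAll_injection_of_card_le h _ (card_le_g_of_classes hlh fun ξ _ h𝓔 =>
    rigidOK_g_of_junctions_frozen (J := J) h𝓤 h𝓓 h𝓓'' h𝓤' (hfb ξ) h𝓔)


end Graph

section MarkStep

variable {x : V}

/-- **THE GENERAL MARK STEP FROM FROZEN BLOCKS**: row 2′SW-ALL with the mark `x` on every graph
under the frozen block structure on every fibre of every pattern of the mark's edges
(`isolate ends x` = the graph with the mark's edges turned into loops at the mark,
`markU ends d x` / `markD ends d x` / `markD'' ends d x` = the pattern's families; the fibres of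
the escaping set of the junctions `J` in `{l}ᶜ`). -/
theorem swAll_markStep_of_junctions_frozen (hlh : l ≠ h) (hxl : x ≠ l) (hxh : x ≠ h)
    {J : Finset V}
    (hfb : ∀ d : Config E, ∀ ξ, ∀ T ⊆ J, FrozenBlocks (isolate ends x) l h (markU ends d x)
      (markD ends d x) (markD'' ends d x) {x} Set.univ ({l}ᶜ) ξ fun ζ =>
        (∀ r ∈ insert h (↑(J \ T) : Set V), hull (isolate ends x) ζ r ⊆ ({l}ᶜ : Set V)) ∧
          (∀ u ∈ (↑T : Set V), ¬ hull (isolate ends x) ζ u ⊆ ({l}ᶜ : Set V))) :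
    SwAll ends l h x := by
  refine swAll_of_gTyped_patterns hxl hxh fun d _ => ?_
  exact gTypedSwAll_of_junctions_frozen (J := J) hlh (isUpperSet_markU d x) (isLowerSet_markD d x)
    (isLowerSet_markD'' d x) isUpperSet_univ (hfb d)

/-- **Row (SW) from the general mark step from frozen blocks.** -/
theorem sw_markStep_of_junctions_frozen (hlh : l ≠ h) (hxl : x ≠ l) (hxh : x ≠ h)
    {J : Finset V}
    (hfb : ∀ d : Config E, ∀ ξ, ∀ T ⊆ J, FrozenBlocks (isolate ends x) l h (markU ends d x)
      (markD ends d x) (markD'' ends d x) {x} Set.univ ({l}ᶜ) ξ fun ζ =>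
        (∀ r ∈ insert h (↑(J \ T) : Set V), hull (isolate ends x) ζ r ⊆ ({l}ᶜ : Set V)) ∧
          (∀ u ∈ (↑T : Set V), ¬ hull (isolate ends x) ζ u ⊆ ({l}ᶜ : Set V))) :
    Sw ends l h x :=
  sw_of_swAll ends (swAll_markStep_of_junctions_frozen hlh hxl hxh hfb)


end MarkStep

end Blocks

end LocRows

end Summit.Ventures.PercRepro2
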